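import Mathlib
import Summits.Ventures.FusionMHD.Models.CerfonFreidbergIterLikeQHalfShearDefs
import HarnessLib

/-!
# Ventures/FusionMHD — Models/CerfonFreidbergIterLikeQHalfShearPanels11.lean: KERNEL CHECK of the shear-register certificates of panels 20, 21 (of 32)
# at `ψ_N = 1/2` of THE Cerfon–Freidberg ITER-like instance

HONEST FRAMING (LADDER-GRIDFUSION three columns; CF rung; successor step of «q′(ψ_N = 1/2) on the CF rung», F2-SCOPING v1.6 §10(c)).  One `decide +kernel`
(≈ 80 s): for each listed panel the obligation `CFIterLike.QHalfShear.ShearCert.ok` (`Models/CerfonFreidbergIterLikeQHalfShearDefs.lean`) — the Taylor-model run of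
`progQ = CFIterLike.QHalf.progA ++ blockQ` over ★ #117's parameter box is ACCEPTED and the kernel's panel-integral enclosure of the shear kernel `K·p` along the
approximant lies inside the claimed integers (read off a compiled `#eval` of the same functions, slack one unit of `2⁻⁶⁰`; float truth inside every panel).
MODELLED: analytic Cerfon–Freidberg family; nothing about a device or stability.  No `native_decide`.  Typer/prover: gridfusion-model-5 (g8), 2026-08-27.
Citations: Freidberg 2014 §6.3.5 (6.35) [Freidberg2014]; Mahboubi–Melquiond–Sibut-Pinote 2016 §3.2 Lemma 3 [MahboubiMelquiondSibutpinote2016].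
-/

namespace Summit.Ventures.FusionMHD.Models.CFIterLike.QHalfShear

/-- Shear-register certificate data of panels 20, 21. [instance data] -/
def shearCert11 : List ShearCert := [
  { j := 20, cand := [2424349227180785401856, -196284790322105122816, -137867208690581423259648, 416106526991708699230208, 6608366222417812420296704, -43692269244617943708336128, -221179392526530937282887680, 3074297096162013221708890112, 1712645154905256230014418944, -168333182894492744892561752064, 471106307330154685535262605312, 7036072096146430224096890454016, -47676739070391441228185062080512],
    deg := 10, elog2 := 46, plo := 13976618917207551096, phi := 13976620028143877477 },
  { j := 21, cand := [2301158872597040726016, -7015879337143586258944, -74814379303953869307904, 775173900534555273592832, -554890573017078061596672, -33982529412179354347110400, 215669309240873267700432896, 374861845287926608227729408, -12043462576824666614631759872, 50524755420866793836835241984, 261444712758227413636772528128, -3675136348363688749146151321600, 10210917063738529452331546705920],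
    deg := 10, elog2 := 46, plo := 14206872534163815908, phi := 14206873671075430543 }]

/-- **KERNEL CHECK** of the shear register on panels 20, 21. -/
theorem shearCert11_ok : CFIterLike.QHalfShear.shearCert11.all ShearCert.ok = true := by
  decide +kernel

end Summit.Ventures.FusionMHD.Models.CFIterLike.QHalfShear
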